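import Summits.ABC.ABC.Theses.RootDecompG
import HarnessLib

/-!
# Route RootDecompG — split glue `KummerFloorCell4OfChildren` (item stmt-ABC-28098)

`BalKummerCell4 → LopKummerCell4 → KummerFloorCell4`
(`Summit.ABC.ABC.Theses.RootDecompG.KummerFloorCell4OfChildren`): the ε-tied archimedean proximity cut of
the level-4 Kummer cell `{c ≤ K·N₄(abc)⁵}` — `C := max C_Bal C_Lop` and the case split
`c^(1−ε) < min(a,b)` (balanced) vs `min(a,b) ≤ c^(1−ε)` (lopsided) (lens-6 gen-5 KummerProximityCut,
kernel `cell4Glue`; cell decomp-abc writer LANDING LIST, door G).  Bookkeeping only (size S); proves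
neither `ABC` nor any crux.
-/

set_option linter.dupNamespace false

namespace Summit.ABC.ABC.Theorems

/-- Item stmt-ABC-28098, literally the route decl `RootDecompG.KummerFloorCell4OfChildren`. -/
theorem rootDecompG_kummerFloorCell4OfChildren_proof :
    Summit.ABC.ABC.Theses.RootDecompG.KummerFloorCell4OfChildren := by
  unfold Summit.ABC.ABC.Theses.RootDecompG.KummerFloorCell4OfChildren
    Summit.ABC.ABC.Theses.RootDecompG.BalKummerCell4 Summit.ABC.ABC.Theses.RootDecompG.LopKummerCell4
    Summit.ABC.ABC.Theses.RootDecompG.KummerFloorCell4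
  intro hBal hLop K ε hε
  obtain ⟨C₁, hC₁, h₁⟩ := hBal K ε hε
  obtain ⟨C₂, hC₂, h₂⟩ := hLop K ε hε
  refine ⟨max C₁ C₂, lt_max_of_lt_left hC₁, fun a b c ht hcell => ?_⟩
  have hR0 : (0 : ℝ) ≤ ((Literature.NumberTheory.DiophantineGeometry.rad a b c : ℕ) : ℝ) ^ (1 + ε) :=
    Real.rpow_nonneg (Nat.cast_nonneg _) _
  rcases lt_or_ge ((c : ℝ) ^ (1 - ε)) ((min a b : ℕ) : ℝ) with hbal | hlop
  · exact (h₁ a b c ht hcell hbal).trans_le (mul_le_mul_of_nonneg_right (le_max_left _ _) hR0)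
  · exact (h₂ a b c ht hcell hlop).trans_le (mul_le_mul_of_nonneg_right (le_max_right _ _) hR0)

end Summit.ABC.ABC.Theorems
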